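import Summits.HodgeConjecture.HodgeConjecture.Theorems.WeilTypeLadderFermatTransfer
import Literature.AlgebraicGeometry.HodgeTheory.WeilClassesCyclicPrymTyping
import HarnessLib

/-!
# WeilTypeLadder · the transfer principle with an ARBITRARY target on which the middle Hodge classes are
# algebraic, and the cyclotomic case bodies it serves (`ℤ/18`-covers of `ℙ¹` with four branch points)

b2b cell `hweil` (packet `run/shared/lean/b2b/hodge-weil/`, report `b2b-hweil-pv3-g39/ORDERING-LEMMA.md` §3,
PROPOSITION CYC). Companion of `Theorems/WeilTypeLadderFermatTransfer` / `…FermatTransferMulti` (target a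
Fermat variety `Xᵏₘ`, Shioda's theorem as a named fact).

Why an arbitrary target. For the `ζ_m`-primitive Prym `B` of a `ℤ/m`-cover `C → ℙ¹` with `N = h + 2` branch
points and an imaginary quadratic SUBFIELD `K ⊂ E = ℚ(ζ_m)`, `[E:K] = ℓ`, the `K`-Weil classes of `B` are cup
products of `ℓ` partial classes `⋀ʰ V_n` (`n` running over a coset of `Gal(E/K)` in `(ℤ/m)ˣ`); on `C^{ℓh}` they
are sums of pull-backs, along coordinate projections, of exterior products `u_{n₁} ⊠ ⋯ ⊠ u_{n_ℓ}` of Schoen's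
classes `u_n ∈ Hʰ(Cʰ)^G = Hʰ(Xʰₘ/Γ)` (KEY LEMMA `Cʰ/G ≅ Xʰₘ/ker β`), so their Fermat partners live on the
PRODUCT `(Xʰₘ)^ℓ` of Fermat varieties — not a Fermat variety. The Hodge classes of such a product are algebraic
by Shioda's product theorem (Proc. Japan Acad. 55A (1979) 112, Thm. 2: "Fix `m > 1`. If the condition
`(P^n_m)` is satisfied [for all `n`; verified for `m` prime and for `m ≤ 20`], then the Hodge Conjecture for
arbitrary product `X^{n₁}_m × ⋯ × X^{n_k}_m` is true"), which the tree does not carry as a named fact. This file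
therefore makes the algebraicity of the rational `(p,p)`-classes OF THE TARGET an explicit HYPOTHESIS
`hXH : span ℂ {rational (p,p)-classes of X'} ≤ algebraicClasses X' p` (for `X' = Xᵏₘ` it is Shioda's fact, see
`span_rational_hodge_le_algebraicClasses_of_fermat`; for `X' = (Xʰₘ)^ℓ` it is Shioda's Thm. 2, cited in the
packet) and proves:

* `mem_algebraicClasses_of_targetTransferFamily` — `X'` smooth projective with `hXH`; `Z`, `T` smooth projective
  of the same dimension; `a : T ⟶ Z` surjective; `b : ι → (T ⟶ X')` any family; if
  `a^* c ∈ ⨆ᵢ (bᵢ)^*(span of the rational (p,p)-classes of X')` then `c ∈ algebraicClasses Z p`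
  (Fulton per `bᵢ`, `iSup_le`, degree trick). Named-fact binder: `fulton1998_map_mem_algebraicClasses` only.
* `span_rational_hodge_le_algebraicClasses_of_fermat` — the hypothesis `hXH` for a Fermat target IS Shioda's
  fact (so `…FermatTransferMulti` is the special case `X' = Xᵏₘ`).
* `abelianVariety_mem_algebraicClasses_of_targetTransferFamily` — `Z = A` an abelian variety.
* `nonsplitSixfolds_targetTransfer_of_facts` / `_of_nonsplitSixfolds` / `_of_hodgeConjecture` — the body of
  R1′ (`NonsplitSixfolds`, every `d`, rung binders VERBATIM FIRST incl. the non-hyperbolicity binder), then the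
  datum `(X', k, hXH, T, a, ι, b)`, then per class of the Weil plane with `a^* c ∈ ⨆ᵢ …`: rational `(3,3)` ⇒
  algebraic — from the fact / from the rung / ON-PATH from `HodgeConjecture`.
* `nonsplitSixfolds_cyclicOctodecicPrym_of_facts` / `_of_nonsplitSixfolds` / `_of_hodgeConjecture` — the same
  on the NAMED FAMILY of the packet's CASE C18: `C` smooth projective curve with `α`, `α¹⁸ = 𝟙`,
  `s = α_*` on a Jacobian `J`, `Σ_{i<18} sⁱ = 0` (`C/α ≅ ℙ¹`), `B := (ker Φ₁₈(s))⁰ = kerComponent(𝟙 − s³ + s⁶)`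
  of dimension `6` (`= 4` branch points), `t = s_B⁶` (`= ζ₃` on `B`), `ψ₀ = t − t²` (`= √-3`, `ψ₀² = −3`:
  `K = ℚ(√-3)`, `d = 3`); by the packet's THEOREM SCAN-CYC the rotation tuple `(1,4,4,9)`
  (`y¹⁸ = (x−b₁)(x−b₂)⁴(x−b₃)⁴(x−b₄)⁹`) gives `(B, ψ₀)` of Weil type `(3,3)` and NON-SPLIT (class `−2`).

HONEST LABEL: which abelian varieties carry the datum (every member of the `ℤ/18` family, PROPOSITION CYC), that
the target's Hodge classes are algebraic (Shioda 1979 Thm. 2 for `(X²₁₈)³`, refereed, CITED not typed) and that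
the family is non-split with `End⁰ = ℚ(ζ₉)` generically (THEOREM SCAN-CYC, machine-exact + Rohde 2009) are NOT
decided in the kernel; sub-families, not general members; 0 unconditional rungs; Markman-free. No `sorry`, no
new definition, no new named fact.
-/

noncomputable section

-- every declaration of this problem lives in `Summit.HodgeConjecture.HodgeConjecture.…` (summit = sub-problem)
set_option linter.dupNamespace false

open CategoryTheory
open Literature.AlgebraicGeometry Literature.AlgebraicGeometry.Motives
open Literature.AlgebraicGeometry.HodgeTheory
open Literature.AlgebraicTopology.SingularHomology

namespace Summit.HodgeConjecture.HodgeConjecture.WeilTypeLadder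

/-! ### §1 The transfer principle with an arbitrary target -/

section Principle

universe u

variable {k m z p : ℕ} {X T Z : Motives.SchemeOver ℂ} {ι : Type u}

/-- **The transfer principle, target form.** `X'` smooth projective of dimension `k` on which the `ℂ`-span of
the rational `(p,p)`-classes consists of algebraic classes (`hXH`); `Z`, `T` smooth projective of the same
dimension `z`; `a : T ⟶ Z` surjective; `b : ι → (T ⟶ X')` any family of morphisms. If `a^* c` lies in the sum
over `i` of the `bᵢ`-pull-backs of that span, then `c ∈ Nᵖ H²ᵖ(Z(ℂ))`.
[cite: Fulton1998, §19.2 Cor. 19.2 (b)] [cite: VoisinHodgeI2002, §7.3.2 Remark 7.29] -/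
theorem mem_algebraicClasses_of_targetTransferFamily
    (hP : fulton1998_map_mem_algebraicClasses) (hX : IsSmoothProjective k X)
    (hXH : Submodule.span ℂ
        {x : complexBetti X (2 * p) | IsRationalClass x ∧ IsOfHodgeType k X (2 * p) p p x} ≤
          algebraicClasses X p)
    (hZ : IsSmoothProjective z Z) (hT : IsSmoothProjective z T)
    (a : T ⟶ Z) [AlgebraicGeometry.Surjective a.left] (b : ι → (T ⟶ X))
    {c : complexBetti Z (2 * p)}
    (hc : complexBetti.map a (2 * p) c ∈ ⨆ i, (Submodule.span ℂ
        {x : complexBetti X (2 * p) | IsRationalClass x ∧ IsOfHodgeType k X (2 * p) p p x}).map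
          (complexBetti.map (b i) (2 * p)).hom) :
    c ∈ algebraicClasses Z p := by
  -- each summand consists of algebraic classes of `T`: `hXH` on `X'`, then Fulton along `b i`
  have hle : (⨆ i, (Submodule.span ℂ
      {x : complexBetti X (2 * p) | IsRationalClass x ∧ IsOfHodgeType k X (2 * p) p p x}).map
        (complexBetti.map (b i) (2 * p)).hom) ≤ algebraicClasses T p := by
    refine iSup_le fun i ↦ Submodule.map_le_iff_le_comap.2 fun x hx ↦ ?_
    exact hP (b i) hX hT p x (hXH hx)
  -- degree trick along the surjective equidimensional `a`
  exact mem_algebraicClasses_of_map_mem_of_surjective hT hZ a (hle hc)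

/-- **For a Fermat target the hypothesis `hXH` is Shioda's theorem**: on `X = Xᵏₘ` (`m` prime or
`1 < m ≤ 20`) the span of the rational `(p,p)`-classes consists of algebraic classes.
[cite: Shioda1979PJA, §2 Thm. 1 and the list after it (p. 112)] -/
theorem span_rational_hodge_le_algebraicClasses_of_fermat (hF : hodgeClasses_algebraic_fermat)
    (hm : m.Prime ∨ (1 < m ∧ m ≤ 20)) (hXF : IsFermatVariety k m X) (hX : IsSmoothProjective k X) :
    Submodule.span ℂ {x : complexBetti X (2 * p) | IsRationalClass x ∧ IsOfHodgeType k X (2 * p) p p x} ≤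
      algebraicClasses X p :=
  Submodule.span_le.2 fun y hy ↦ hF hm hXF hX p y hy.1 hy.2

/-- **The target transfer principle on an abelian variety** (`Z = A`, smooth projective of dimension
`dim A`): the transfer of PROPOSITION CYC of the packet (`A = B` a cyclotomic Prym, `X' = (Xʰₘ)^ℓ`, `T` over
`C^{ℓh}`, `bᵢ` indexed by the ordered `ℓ`-tuples of disjoint `h`-subsets).
[cite: Fulton1998, §19.2 Cor. 19.2 (b)] [cite: Schoen1988HodgeWeil, §1 Lemma 1.2 and §3 Cor. 3.1 (proof, pp. 24–25)] -/
theorem abelianVariety_mem_algebraicClasses_of_targetTransferFamily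
    (hP : fulton1998_map_mem_algebraicClasses) (A : Motives.AbelianVariety ℂ) (hX : IsSmoothProjective k X)
    (hXH : Submodule.span ℂ
        {x : complexBetti X (2 * p) | IsRationalClass x ∧ IsOfHodgeType k X (2 * p) p p x} ≤
          algebraicClasses X p)
    (hT : IsSmoothProjective A.dim T) (a : T ⟶ A.X) [AlgebraicGeometry.Surjective a.left]
    (b : ι → (T ⟶ X)) {c : complexBetti A.X (2 * p)}
    (hc : complexBetti.map a (2 * p) c ∈ ⨆ i, (Submodule.span ℂ
        {x : complexBetti X (2 * p) | IsRationalClass x ∧ IsOfHodgeType k X (2 * p) p p x}).map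
          (complexBetti.map (b i) (2 * p)).hom) :
    c ∈ algebraicClasses A.X p :=
  mem_algebraicClasses_of_targetTransferFamily hP hX hXH
    (Motives.AbelianVariety.isSmoothProjective_holds : IsSmoothProjective A.dim A.X) hT a b hc

end Principle

/-! ### §2 R1′-shaped body (`NonsplitSixfolds`, every `d`) with a target datum -/

section Rone

/-- **R1′ on the target-dominated locus, from the fact.** The body of `NonsplitSixfolds` (rung binders first and
verbatim, every `d`, the non-hyperbolicity binder carried and unused), then a datum `(X', k, hXH, T, a, ι, b)`
— `X'` smooth projective with algebraic rational `(3,3)`-classes, `dim T = 6`, `a` surjective, `b : ι → (T ⟶ X')`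
— then for every class of the Weil plane with `a^* c ∈ ⨆ᵢ (bᵢ)^*(span of the rational (3,3)-classes of X')`:
rational of type `(3,3)` ⇒ algebraic. [cite: Fulton1998, §19.2 Cor. 19.2 (b)]
[cite: Markman2025SurveySecant, §1.1 and §11.5 Step 1] -/
theorem nonsplitSixfolds_targetTransfer_of_facts (hP : fulton1998_map_mem_algebraicClasses) :
    ∀ (d : ℕ), 0 < d → ∀ (A : Motives.AbelianVariety ℂ) (φ : A ⟶ A), A.dim = 2 * 3 →
      Motives.IsSmoothProjective (2 * 3) A.X → φ ≫ φ = -(d • 𝟙 A) →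
      (∀ (e : Motives.ProjectiveEmbedding A.X) (a : complexBetti (Motives.projectiveSpace e.n ℂ) 2),
        IsRationalClass a → a ≠ 0 →
          ¬ Motives.IsHyperbolicWeilType A φ 3
            ((d : ℂ) • complexBetti.map e.ι 2 a +
              complexBetti.map φ.hom.hom.hom 2 (complexBetti.map e.ι 2 a))) →
    ∀ (X T : Motives.SchemeOver ℂ) (k : ℕ), IsSmoothProjective k X →
      Submodule.span ℂ {x : complexBetti X (2 * 3) | IsRationalClass x ∧ IsOfHodgeType k X (2 * 3) 3 3 x} ≤
        algebraicClasses X 3 →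
      IsSmoothProjective (2 * 3) T →
    ∀ (a : T ⟶ A.X), AlgebraicGeometry.Surjective a.left → ∀ (ι : Type) (b : ι → (T ⟶ X)),
      ∀ c : complexBetti A.X (2 * 3),
        complexBetti.map a (2 * 3) c ∈ (⨆ i, (Submodule.span ℂ
            {x : complexBetti X (2 * 3) | IsRationalClass x ∧ IsOfHodgeType k X (2 * 3) 3 3 x}).map
              (complexBetti.map (b i) (2 * 3)).hom) →
        IsRationalClass c → IsOfHodgeType (2 * 3) A.X (2 * 3) 3 3 c → c ∈ weilClassesOf A φ 3 d →
          c ∈ algebraicClasses A.X 3 := by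
  intro d _ A φ hA _ _ _ X T k hX hXH hT a ha ι b c hc _ _ _
  exact abelianVariety_mem_algebraicClasses_of_targetTransferFamily hP A hX hXH (hA ▸ hT) a b hc

/-- **The same body from the rung R1′ itself** (`NonsplitSixfolds`; the datum is not used): the target-dominated
non-split sixfolds are a CASE of the rung. -/
theorem nonsplitSixfolds_targetTransfer_of_nonsplitSixfolds (h : NonsplitSixfolds) :
    ∀ (d : ℕ), 0 < d → ∀ (A : Motives.AbelianVariety ℂ) (φ : A ⟶ A), A.dim = 2 * 3 →
      Motives.IsSmoothProjective (2 * 3) A.X → φ ≫ φ = -(d • 𝟙 A) →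
      (∀ (e : Motives.ProjectiveEmbedding A.X) (a : complexBetti (Motives.projectiveSpace e.n ℂ) 2),
        IsRationalClass a → a ≠ 0 →
          ¬ Motives.IsHyperbolicWeilType A φ 3
            ((d : ℂ) • complexBetti.map e.ι 2 a +
              complexBetti.map φ.hom.hom.hom 2 (complexBetti.map e.ι 2 a))) →
    ∀ (X T : Motives.SchemeOver ℂ) (k : ℕ), IsSmoothProjective k X →
      Submodule.span ℂ {x : complexBetti X (2 * 3) | IsRationalClass x ∧ IsOfHodgeType k X (2 * 3) 3 3 x} ≤
        algebraicClasses X 3 →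
      IsSmoothProjective (2 * 3) T →
    ∀ (a : T ⟶ A.X), AlgebraicGeometry.Surjective a.left → ∀ (ι : Type) (b : ι → (T ⟶ X)),
      ∀ c : complexBetti A.X (2 * 3),
        complexBetti.map a (2 * 3) c ∈ (⨆ i, (Submodule.span ℂ
            {x : complexBetti X (2 * 3) | IsRationalClass x ∧ IsOfHodgeType k X (2 * 3) 3 3 x}).map
              (complexBetti.map (b i) (2 * 3)).hom) →
        IsRationalClass c → IsOfHodgeType (2 * 3) A.X (2 * 3) 3 3 c → c ∈ weilClassesOf A φ 3 d →
          c ∈ algebraicClasses A.X 3 := by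
  intro d hd A φ hA hS hφ hnh _ _ _ _ _ _ _ _ _ _ c _ hr ht hw
  exact h d hd A φ hA hS hφ hnh c hr ht hw

/-- **On-path lemma**: the Hodge conjecture implies R1′ on the target-dominated locus
(`HodgeConjecture → NonsplitSixfolds →` the locus). -/
theorem nonsplitSixfolds_targetTransfer_of_hodgeConjecture (h : _root_.HodgeConjecture) :
    ∀ (d : ℕ), 0 < d → ∀ (A : Motives.AbelianVariety ℂ) (φ : A ⟶ A), A.dim = 2 * 3 →
      Motives.IsSmoothProjective (2 * 3) A.X → φ ≫ φ = -(d • 𝟙 A) →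
      (∀ (e : Motives.ProjectiveEmbedding A.X) (a : complexBetti (Motives.projectiveSpace e.n ℂ) 2),
        IsRationalClass a → a ≠ 0 →
          ¬ Motives.IsHyperbolicWeilType A φ 3
            ((d : ℂ) • complexBetti.map e.ι 2 a +
              complexBetti.map φ.hom.hom.hom 2 (complexBetti.map e.ι 2 a))) →
    ∀ (X T : Motives.SchemeOver ℂ) (k : ℕ), IsSmoothProjective k X →
      Submodule.span ℂ {x : complexBetti X (2 * 3) | IsRationalClass x ∧ IsOfHodgeType k X (2 * 3) 3 3 x} ≤
        algebraicClasses X 3 →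
      IsSmoothProjective (2 * 3) T →
    ∀ (a : T ⟶ A.X), AlgebraicGeometry.Surjective a.left → ∀ (ι : Type) (b : ι → (T ⟶ X)),
      ∀ c : complexBetti A.X (2 * 3),
        complexBetti.map a (2 * 3) c ∈ (⨆ i, (Submodule.span ℂ
            {x : complexBetti X (2 * 3) | IsRationalClass x ∧ IsOfHodgeType k X (2 * 3) 3 3 x}).map
              (complexBetti.map (b i) (2 * 3)).hom) →
        IsRationalClass c → IsOfHodgeType (2 * 3) A.X (2 * 3) 3 3 c → c ∈ weilClassesOf A φ 3 d →
          c ∈ algebraicClasses A.X 3 :=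
  nonsplitSixfolds_targetTransfer_of_nonsplitSixfolds (nonsplitSixfolds_of_hodgeConjecture h)

end Rone

/-! ### §3 The named family of CASE C18: `ζ₁₈`-primitive Pryms of `ℤ/18`-covers of `ℙ¹` with four branch points -/

section CyclicOctodecic

/-- **R1′ on the `ℤ/18` cyclotomic family, from the fact.** Binders: a smooth projective curve `C` with an
automorphism `α` of order dividing `18`, a Jacobian `𝒥` of `C`, `s = α_*` on `J = 𝒥.J`, the `ℙ¹`-quotient
relation `Σ_{i<18} sⁱ = 0` (the norm of `C → C/α` kills `J` iff `J(C/α) = 0`), the `ζ₁₈`-primitive Prym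
`B := kerComponent (𝟙 − s³ + s⁶)` (`Φ₁₈(x) = x⁶ − x³ + 1`) of dimension `6` (`⟺` four branch points), the
restriction `sB` of `s` to `B`, `t = sB⁶` (`= ζ₃` on `B`) and `ψ₀ = t − t²` (`= ζ₃ − ζ₃² = √-3`); then the rung's
binders `IsSmoothProjective 6 B`, `ψ₀² = −3`, non-hyperbolicity (`d = 3`), then the target datum, then the
per-class conclusion on `weilClassesOf B ψ₀ 3 3`. The packet's family `y¹⁸ = (x−b₁)(x−b₂)⁴(x−b₃)⁴(x−b₄)⁹`
(THEOREM SCAN-CYC: Weil type `(3,3)` for `ℚ(√-3)`, discriminant class `−2`) is the intended instance; the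
datum with `X' = (X²₁₈)³` is PROPOSITION CYC (pen-and-paper) and `hXH` there is Shioda 1979 Thm. 2.
[cite: Fulton1998, §19.2 Cor. 19.2 (b)] [cite: Schoen1988HodgeWeil, §1 Lemma 1.2, Lemma 1.5, Cor. 1.9]
[cite: Shioda1979PJA, §2 Thm. 2 (p. 112)] -/
theorem nonsplitSixfolds_cyclicOctodecicPrym_of_facts (hP : fulton1998_map_mem_algebraicClasses) :
    ∀ (C : Motives.SchemeOver ℂ) (𝒥 : Jacobian C) (α : C ⟶ C),
      IsSmoothProjective 1 C → CategoryTheory.End.of α ^ 18 = 1 →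
    ∀ (s : 𝒥.J ⟶ 𝒥.J), s = 𝒥.pushforward 𝒥 α →
      (∑ i ∈ Finset.range 18, CategoryTheory.End.of s ^ i) = 0 →
    ∀ (sB t ψ₀ : AbelianVariety.kerComponent (𝟙 𝒥.J - s ≫ s ≫ s + s ≫ s ≫ s ≫ s ≫ s ≫ s) ⟶
        AbelianVariety.kerComponent (𝟙 𝒥.J - s ≫ s ≫ s + s ≫ s ≫ s ≫ s ≫ s ≫ s)),
      sB ≫ AbelianVariety.kerComponentι (𝟙 𝒥.J - s ≫ s ≫ s + s ≫ s ≫ s ≫ s ≫ s ≫ s) =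
        AbelianVariety.kerComponentι (𝟙 𝒥.J - s ≫ s ≫ s + s ≫ s ≫ s ≫ s ≫ s ≫ s) ≫ s →
      t = sB ≫ sB ≫ sB ≫ sB ≫ sB ≫ sB → ψ₀ = t - t ≫ t →
      (AbelianVariety.kerComponent (𝟙 𝒥.J - s ≫ s ≫ s + s ≫ s ≫ s ≫ s ≫ s ≫ s)).dim = 2 * 3 →
      IsSmoothProjective (2 * 3) (AbelianVariety.kerComponent (𝟙 𝒥.J - s ≫ s ≫ s + s ≫ s ≫ s ≫ s ≫ s ≫ s)).X →
      ψ₀ ≫ ψ₀ = -((3 : ℕ) • 𝟙 _) →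
      (∀ (e : Motives.ProjectiveEmbedding
          (AbelianVariety.kerComponent (𝟙 𝒥.J - s ≫ s ≫ s + s ≫ s ≫ s ≫ s ≫ s ≫ s)).X)
        (a : complexBetti (Motives.projectiveSpace e.n ℂ) 2), IsRationalClass a → a ≠ 0 →
          ¬ Motives.IsHyperbolicWeilType
              (AbelianVariety.kerComponent (𝟙 𝒥.J - s ≫ s ≫ s + s ≫ s ≫ s ≫ s ≫ s ≫ s)) ψ₀ 3
            (((3 : ℕ) : ℂ) • complexBetti.map e.ι 2 a +
              complexBetti.map ψ₀.hom.hom.hom 2 (complexBetti.map e.ι 2 a))) →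
    ∀ (X T : Motives.SchemeOver ℂ) (k : ℕ), IsSmoothProjective k X →
      Submodule.span ℂ {x : complexBetti X (2 * 3) | IsRationalClass x ∧ IsOfHodgeType k X (2 * 3) 3 3 x} ≤
        algebraicClasses X 3 →
      IsSmoothProjective (2 * 3) T →
    ∀ (a : T ⟶ (AbelianVariety.kerComponent (𝟙 𝒥.J - s ≫ s ≫ s + s ≫ s ≫ s ≫ s ≫ s ≫ s)).X),
      AlgebraicGeometry.Surjective a.left → ∀ (ι : Type) (b : ι → (T ⟶ X)),
      ∀ c : complexBetti (AbelianVariety.kerComponent (𝟙 𝒥.J - s ≫ s ≫ s + s ≫ s ≫ s ≫ s ≫ s ≫ s)).X (2 * 3),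
        complexBetti.map a (2 * 3) c ∈ (⨆ i, (Submodule.span ℂ
            {x : complexBetti X (2 * 3) | IsRationalClass x ∧ IsOfHodgeType k X (2 * 3) 3 3 x}).map
              (complexBetti.map (b i) (2 * 3)).hom) →
        IsRationalClass c →
        IsOfHodgeType (2 * 3) (AbelianVariety.kerComponent (𝟙 𝒥.J - s ≫ s ≫ s + s ≫ s ≫ s ≫ s ≫ s ≫ s)).X
          (2 * 3) 3 3 c →
        c ∈ weilClassesOf (AbelianVariety.kerComponent (𝟙 𝒥.J - s ≫ s ≫ s + s ≫ s ≫ s ≫ s ≫ s ≫ s)) ψ₀ 3 3 →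
        c ∈ algebraicClasses (AbelianVariety.kerComponent (𝟙 𝒥.J - s ≫ s ≫ s + s ≫ s ≫ s ≫ s ≫ s ≫ s)).X 3 := by
  intro C 𝒥 α _ _ s _ _ sB t ψ₀ _ _ _ hB _ _ _ X T k hX hXH hT a ha ι b c hc _ _ _
  exact abelianVariety_mem_algebraicClasses_of_targetTransferFamily hP _ hX hXH (hB ▸ hT) a b hc

/-- **The same body from the rung R1′ itself** (`NonsplitSixfolds` at `d = 3`, `(A, φ) := (B, ψ₀)`; family and
datum not used): the non-split members of the `ℤ/18` family are a CASE of the rung. -/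
theorem nonsplitSixfolds_cyclicOctodecicPrym_of_nonsplitSixfolds (h : NonsplitSixfolds) :
    ∀ (C : Motives.SchemeOver ℂ) (𝒥 : Jacobian C) (α : C ⟶ C),
      IsSmoothProjective 1 C → CategoryTheory.End.of α ^ 18 = 1 →
    ∀ (s : 𝒥.J ⟶ 𝒥.J), s = 𝒥.pushforward 𝒥 α →
      (∑ i ∈ Finset.range 18, CategoryTheory.End.of s ^ i) = 0 →
    ∀ (sB t ψ₀ : AbelianVariety.kerComponent (𝟙 𝒥.J - s ≫ s ≫ s + s ≫ s ≫ s ≫ s ≫ s ≫ s) ⟶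
        AbelianVariety.kerComponent (𝟙 𝒥.J - s ≫ s ≫ s + s ≫ s ≫ s ≫ s ≫ s ≫ s)),
      sB ≫ AbelianVariety.kerComponentι (𝟙 𝒥.J - s ≫ s ≫ s + s ≫ s ≫ s ≫ s ≫ s ≫ s) =
        AbelianVariety.kerComponentι (𝟙 𝒥.J - s ≫ s ≫ s + s ≫ s ≫ s ≫ s ≫ s ≫ s) ≫ s →
      t = sB ≫ sB ≫ sB ≫ sB ≫ sB ≫ sB → ψ₀ = t - t ≫ t →
      (AbelianVariety.kerComponent (𝟙 𝒥.J - s ≫ s ≫ s + s ≫ s ≫ s ≫ s ≫ s ≫ s)).dim = 2 * 3 →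
      IsSmoothProjective (2 * 3) (AbelianVariety.kerComponent (𝟙 𝒥.J - s ≫ s ≫ s + s ≫ s ≫ s ≫ s ≫ s ≫ s)).X →
      ψ₀ ≫ ψ₀ = -((3 : ℕ) • 𝟙 _) →
      (∀ (e : Motives.ProjectiveEmbedding
          (AbelianVariety.kerComponent (𝟙 𝒥.J - s ≫ s ≫ s + s ≫ s ≫ s ≫ s ≫ s ≫ s)).X)
        (a : complexBetti (Motives.projectiveSpace e.n ℂ) 2), IsRationalClass a → a ≠ 0 →
          ¬ Motives.IsHyperbolicWeilType
              (AbelianVariety.kerComponent (𝟙 𝒥.J - s ≫ s ≫ s + s ≫ s ≫ s ≫ s ≫ s ≫ s)) ψ₀ 3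
            (((3 : ℕ) : ℂ) • complexBetti.map e.ι 2 a +
              complexBetti.map ψ₀.hom.hom.hom 2 (complexBetti.map e.ι 2 a))) →
    ∀ (X T : Motives.SchemeOver ℂ) (k : ℕ), IsSmoothProjective k X →
      Submodule.span ℂ {x : complexBetti X (2 * 3) | IsRationalClass x ∧ IsOfHodgeType k X (2 * 3) 3 3 x} ≤
        algebraicClasses X 3 →
      IsSmoothProjective (2 * 3) T →
    ∀ (a : T ⟶ (AbelianVariety.kerComponent (𝟙 𝒥.J - s ≫ s ≫ s + s ≫ s ≫ s ≫ s ≫ s ≫ s)).X),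
      AlgebraicGeometry.Surjective a.left → ∀ (ι : Type) (b : ι → (T ⟶ X)),
      ∀ c : complexBetti (AbelianVariety.kerComponent (𝟙 𝒥.J - s ≫ s ≫ s + s ≫ s ≫ s ≫ s ≫ s ≫ s)).X (2 * 3),
        complexBetti.map a (2 * 3) c ∈ (⨆ i, (Submodule.span ℂ
            {x : complexBetti X (2 * 3) | IsRationalClass x ∧ IsOfHodgeType k X (2 * 3) 3 3 x}).map
              (complexBetti.map (b i) (2 * 3)).hom) →
        IsRationalClass c →
        IsOfHodgeType (2 * 3) (AbelianVariety.kerComponent (𝟙 𝒥.J - s ≫ s ≫ s + s ≫ s ≫ s ≫ s ≫ s ≫ s)).X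
          (2 * 3) 3 3 c →
        c ∈ weilClassesOf (AbelianVariety.kerComponent (𝟙 𝒥.J - s ≫ s ≫ s + s ≫ s ≫ s ≫ s ≫ s ≫ s)) ψ₀ 3 3 →
        c ∈ algebraicClasses (AbelianVariety.kerComponent (𝟙 𝒥.J - s ≫ s ≫ s + s ≫ s ≫ s ≫ s ≫ s ≫ s)).X 3 := by
  intro C 𝒥 α _ _ s _ _ sB t ψ₀ _ _ _ hB hS hψ hnh _ _ _ _ _ _ _ _ _ _ c _ hr ht hw
  exact h 3 (by norm_num) _ ψ₀ hB hS (by simpa using hψ) hnh c hr ht hw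

/-- **On-path lemma**: the Hodge conjecture implies R1′ on the `ℤ/18` cyclotomic family
(`HodgeConjecture → NonsplitSixfolds →` the family). -/
theorem nonsplitSixfolds_cyclicOctodecicPrym_of_hodgeConjecture (h : _root_.HodgeConjecture) :
    ∀ (C : Motives.SchemeOver ℂ) (𝒥 : Jacobian C) (α : C ⟶ C),
      IsSmoothProjective 1 C → CategoryTheory.End.of α ^ 18 = 1 →
    ∀ (s : 𝒥.J ⟶ 𝒥.J), s = 𝒥.pushforward 𝒥 α →
      (∑ i ∈ Finset.range 18, CategoryTheory.End.of s ^ i) = 0 →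
    ∀ (sB t ψ₀ : AbelianVariety.kerComponent (𝟙 𝒥.J - s ≫ s ≫ s + s ≫ s ≫ s ≫ s ≫ s ≫ s) ⟶
        AbelianVariety.kerComponent (𝟙 𝒥.J - s ≫ s ≫ s + s ≫ s ≫ s ≫ s ≫ s ≫ s)),
      sB ≫ AbelianVariety.kerComponentι (𝟙 𝒥.J - s ≫ s ≫ s + s ≫ s ≫ s ≫ s ≫ s ≫ s) =
        AbelianVariety.kerComponentι (𝟙 𝒥.J - s ≫ s ≫ s + s ≫ s ≫ s ≫ s ≫ s ≫ s) ≫ s →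
      t = sB ≫ sB ≫ sB ≫ sB ≫ sB ≫ sB → ψ₀ = t - t ≫ t →
      (AbelianVariety.kerComponent (𝟙 𝒥.J - s ≫ s ≫ s + s ≫ s ≫ s ≫ s ≫ s ≫ s)).dim = 2 * 3 →
      IsSmoothProjective (2 * 3) (AbelianVariety.kerComponent (𝟙 𝒥.J - s ≫ s ≫ s + s ≫ s ≫ s ≫ s ≫ s ≫ s)).X →
      ψ₀ ≫ ψ₀ = -((3 : ℕ) • 𝟙 _) →
      (∀ (e : Motives.ProjectiveEmbedding
          (AbelianVariety.kerComponent (𝟙 𝒥.J - s ≫ s ≫ s + s ≫ s ≫ s ≫ s ≫ s ≫ s)).X)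
        (a : complexBetti (Motives.projectiveSpace e.n ℂ) 2), IsRationalClass a → a ≠ 0 →
          ¬ Motives.IsHyperbolicWeilType
              (AbelianVariety.kerComponent (𝟙 𝒥.J - s ≫ s ≫ s + s ≫ s ≫ s ≫ s ≫ s ≫ s)) ψ₀ 3
            (((3 : ℕ) : ℂ) • complexBetti.map e.ι 2 a +
              complexBetti.map ψ₀.hom.hom.hom 2 (complexBetti.map e.ι 2 a))) →
    ∀ (X T : Motives.SchemeOver ℂ) (k : ℕ), IsSmoothProjective k X →
      Submodule.span ℂ {x : complexBetti X (2 * 3) | IsRationalClass x ∧ IsOfHodgeType k X (2 * 3) 3 3 x} ≤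
        algebraicClasses X 3 →
      IsSmoothProjective (2 * 3) T →
    ∀ (a : T ⟶ (AbelianVariety.kerComponent (𝟙 𝒥.J - s ≫ s ≫ s + s ≫ s ≫ s ≫ s ≫ s ≫ s)).X),
      AlgebraicGeometry.Surjective a.left → ∀ (ι : Type) (b : ι → (T ⟶ X)),
      ∀ c : complexBetti (AbelianVariety.kerComponent (𝟙 𝒥.J - s ≫ s ≫ s + s ≫ s ≫ s ≫ s ≫ s ≫ s)).X (2 * 3),
        complexBetti.map a (2 * 3) c ∈ (⨆ i, (Submodule.span ℂ
            {x : complexBetti X (2 * 3) | IsRationalClass x ∧ IsOfHodgeType k X (2 * 3) 3 3 x}).map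
              (complexBetti.map (b i) (2 * 3)).hom) →
        IsRationalClass c →
        IsOfHodgeType (2 * 3) (AbelianVariety.kerComponent (𝟙 𝒥.J - s ≫ s ≫ s + s ≫ s ≫ s ≫ s ≫ s ≫ s)).X
          (2 * 3) 3 3 c →
        c ∈ weilClassesOf (AbelianVariety.kerComponent (𝟙 𝒥.J - s ≫ s ≫ s + s ≫ s ≫ s ≫ s ≫ s ≫ s)) ψ₀ 3 3 →
        c ∈ algebraicClasses (AbelianVariety.kerComponent (𝟙 𝒥.J - s ≫ s ≫ s + s ≫ s ≫ s ≫ s ≫ s ≫ s)).X 3 :=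
  nonsplitSixfolds_cyclicOctodecicPrym_of_nonsplitSixfolds (nonsplitSixfolds_of_hodgeConjecture h)

end CyclicOctodecic

end Summit.HodgeConjecture.HodgeConjecture.WeilTypeLadder

end
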